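import Summits.RiemannHypothesis.RiemannHypothesis.Theses.LiDirichletEcho
import Summits.RiemannHypothesis.RiemannHypothesis.Theorems.LiPrimeEchoGammaShift
import HarnessLib

/-!
# RiemannHypothesis / LiDirichletEcho — crux K4χ `LiGammaShiftChar`: the gamma edge of `L(s, χ)` IS the character's smooth
# mean, up to `O(log n)` (RH-FREE, GRH-FREE)

RH-FREE · GRH-FREE [rh-li-eng g5, acting as prover on the unstaffed route].  Route `Theses/LiDirichletEcho.lean` (rung
«Li PRIME-ECHO LAW FOR DIRICHLET CHARACTERS» `LiTheory.LiZeroWindowEchoDirichlet`, L-P(P1χ); cell `pub/rh-li`, dossier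
`theory/route/p5`), item `LiGammaShiftChar` (stmt-RiemannHypothesis-19400): for every character `χ` mod `q` (primitivity and
`q > 1` are not used) and `c ≥ 1` there are `N`, `C = C(q)` such that for `n ≥ N`, `√n ≤ T₁ < T₂ ≤ c√n + 1`,

  `|charGammaEdge χ n T₁ T₂ − charSmoothTraceWindow χ n T₁ T₂| ≤ C log n`.

Proof (the ζ template `Theorems/LiPrimeEchoGammaShift.lean` of the CLOSED route LiPrimeEcho with the parity shift `a`
inside `ψ((w + a)/2)` and the constant `½ log(q/π)` in place of `−½ log π`): CAUCHY on `[1/2, 3/2] × [T₁, T₂]` for the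
analytic integrand `G(w) = (½ log(q/π) + ½ ψ((w + a)/2)) k_n(w)` moves the gamma piece from `Re w = 3/2` to the critical line,
where it is EXACTLY the smooth mean: `k_n(½ + it) = 2cos(nθ(t))` (`GammaShift.liSymWeight_half_line`) and
`Re(½ log(q/π) + ½ ψ((½ + a + it)/2)) = charGammaDensity χ t` by definition; the two horizontal connectors have length `1` and
integrand `≤ (½ log(T + 4) + 4 + ½|log(q/π)|)(1 + e)` (`norm_digamma_le_log_height` at `(w + a)/2`, `Re ∈ [¼, 5/4]`,
`|Im| = T/2 ≥ ½`; `|F_n(w)| ≤ 1`, `|F_n(1 − w)| ≤ e`), which is `O_q(log n)` on the window.  Nothing about zeros at all;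
nothing here bears on the truth of RH or GRH.
-/

noncomputable section

-- D-0017: `Summit.<S>.<S>.…` is the designed namespace of a single-problem summit.
set_option linter.dupNamespace false

open Complex MeasureTheory intervalIntegral Set
open scoped Real Interval ComplexConjugate

namespace Summit.RiemannHypothesis.RiemannHypothesis.Theorems.LiTheory

open Literature.NumberTheory.LFunctions

namespace GammaShiftChar

open GammaShift

variable {q : ℕ}

/-- The gamma-edge integrand of `L(s, χ)`: `G(w) = (½ log(q/π) + ½ ψ((w + a)/2)) k_n(w)`, `a = charParity χ`. -/
def gammaIntegrand (χ : DirichletCharacter ℂ q) (n : ℕ) (w : ℂ) : ℂ :=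
  ((Real.log (q / Real.pi) : ℂ) / 2 + 1 / 2 * Complex.digamma ((w + (charParity χ : ℂ)) / 2)) * liSymWeight n w

/-! ### Analyticity on the strip -/

/-- `G` is differentiable at every `w` with `Re w > 0`, `Im w ≠ 0`. -/
theorem differentiableAt_gammaIntegrand (χ : DirichletCharacter ℂ q) (n : ℕ) {w : ℂ} (hre : 0 < w.re)
    (him : w.im ≠ 0) : DifferentiableAt ℂ (gammaIntegrand χ n) w := by
  have hw0 : w ≠ 0 := fun h ↦ him (by simp [h])
  have hw1 : (1 : ℂ) - w ≠ 0 := by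
    intro h; apply him
    have := congrArg Complex.im h; simpa using this.symm
  have ha : (0 : ℝ) ≤ charParity χ := Nat.cast_nonneg _
  have hψ : DifferentiableAt ℂ (fun z : ℂ ↦ Complex.digamma ((z + (charParity χ : ℂ)) / 2)) w := by
    have hmem : (w + (charParity χ : ℂ)) / 2 ∈ {s : ℂ | 0 < s.re} := by
      simp only [mem_setOf_eq, Complex.div_ofNat_re, Complex.add_re, Complex.natCast_re]
      linarith
    have hd := Literature.Analysis.SpecialFunctions.Complex.differentiableOn_digamma.differentiableAt
      ((isOpen_lt continuous_const Complex.continuous_re).mem_nhds hmem)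
    exact hd.comp w ((differentiableAt_id.add_const _).div_const 2)
  have hk : DifferentiableAt ℂ (liSymWeight n) w := by
    unfold liSymWeight
    refine (differentiableAt_liWeight n hw0).add ?_
    exact (differentiableAt_liWeight n hw1).comp w ((differentiableAt_const _).sub differentiableAt_id)
  unfold gammaIntegrand
  exact ((differentiableAt_const _).add ((differentiableAt_const _).mul hψ)).mul hk

/-- `G` is differentiable on every rectangle `[a, b] × [T₁, T₂]` with `a > 0`, `T₁ > 0`. -/
theorem differentiableOn_gammaIntegrand (χ : DirichletCharacter ℂ q) (n : ℕ) {a b T₁ T₂ : ℝ} (ha : 0 < a)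
    (hab : a ≤ b) (hT₁ : 0 < T₁) (hT : T₁ ≤ T₂) :
    DifferentiableOn ℂ (gammaIntegrand χ n) ([[a, b]] ×ℂ [[T₁, T₂]]) := by
  intro w hw
  rw [uIcc_of_le hab, uIcc_of_le hT, Complex.mem_reProdIm] at hw
  exact (differentiableAt_gammaIntegrand χ n (ha.trans_le hw.1.1) (by linarith [hw.2.1])).differentiableWithinAt

/-! ### The critical line: `Re G(½ + it) = 2cos(nθ(t)) g_χ(t)` -/

/-- On the critical line the gamma integrand's real part is the character's smooth density:
`Re G(½ + it) = 2cos(nθ(t)) · charGammaDensity χ t` (`t ≠ 0`). -/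
theorem re_gammaIntegrand_half_line (χ : DirichletCharacter ℂ q) (n : ℕ) {t : ℝ} (ht : t ≠ 0) :
    (gammaIntegrand χ n (1 / 2 + t * I)).re = 2 * Real.cos (n * liZeroAngle t) * charGammaDensity χ t := by
  unfold gammaIntegrand
  rw [liSymWeight_half_line n ht, Complex.re_mul_ofReal]
  have harg : ((1 : ℂ) / 2 + t * I + (charParity χ : ℂ)) / 2 = (1 / 2 + (charParity χ : ℂ) + (t : ℂ) * I) / 2 := by
    ring
  rw [harg]
  unfold charGammaDensity
  rw [Complex.digamma_def]
  have hre : ((Real.log (q / Real.pi) : ℂ) / 2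
      + 1 / 2 * logDeriv Complex.Gamma ((1 / 2 + (charParity χ : ℂ) + (t : ℂ) * I) / 2)).re =
      Real.log (q / Real.pi) / 2 + (logDeriv Complex.Gamma ((1 / 2 + (charParity χ : ℂ) + (t : ℂ) * I) / 2)).re / 2 := by
    simp [Complex.add_re, Complex.mul_re]
    ring
  rw [hre]
  ring

/-! ### The horizontal connectors -/

/-- On a horizontal connector `x ∈ [1/2, 3/2]`, `T ≥ 1`, `T² ≥ n`:
`‖G(x + iT)‖ ≤ (log(T + 4)/2 + 4 + |log(q/π)|/2)(1 + e)`. -/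
theorem norm_gammaIntegrand_le (χ : DirichletCharacter ℂ q) (n : ℕ) {x T : ℝ} (hx : x ∈ Icc (1 / 2 : ℝ) (3 / 2))
    (hT : 1 ≤ T) (hn : (n : ℝ) ≤ T ^ 2) :
    ‖gammaIntegrand χ n (x + T * I)‖ ≤
      (Real.log (T + 4) / 2 + 4 + |Real.log (q / Real.pi)| / 2) * (1 + Real.exp 1) := by
  -- adapted from `GammaShift.norm_gammaIntegrand_le` (Theorems/LiPrimeEchoGammaShift.lean, route LiPrimeEcho)
  have hT0 : 0 < T := by linarith
  have ha0 : (0 : ℝ) ≤ charParity χ := Nat.cast_nonneg _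
  have ha1 : (charParity χ : ℝ) ≤ 1 := by
    have := charParity_le_one χ
    exact_mod_cast this
  set w : ℂ := x + T * I with hw
  set v : ℂ := (w + (charParity χ : ℂ)) / 2 with hv
  -- the digamma factor
  have hψ : ‖(Real.log (q / Real.pi) : ℂ) / 2 + 1 / 2 * Complex.digamma v‖
      ≤ Real.log (T + 4) / 2 + 4 + |Real.log (q / Real.pi)| / 2 := by
    have hvre : 0 < v.re := by
      simp only [hv, hw, Complex.div_ofNat_re, Complex.add_re, Complex.ofReal_re, Complex.mul_re, Complex.I_re,
        Complex.ofReal_im, Complex.I_im, Complex.natCast_re]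
      linarith [hx.1]
    have hvim : 1 / 2 ≤ |v.im| := by
      simp only [hv, hw, Complex.div_ofNat_im, Complex.add_im, Complex.ofReal_im, Complex.mul_im, Complex.I_re,
        Complex.ofReal_re, Complex.I_im, Complex.natCast_im]
      rw [abs_of_pos (by norm_num; positivity)]
      linarith
    have hvn : ‖v‖ ≤ T + 3 := by
      rw [hv, norm_div, Complex.norm_two]
      have : ‖w + (charParity χ : ℂ)‖ ≤ |x| + |T| + charParity χ := by
        calc ‖w + (charParity χ : ℂ)‖ ≤ ‖w‖ + ‖(charParity χ : ℂ)‖ := norm_add_le _ _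
          _ ≤ (‖(x : ℂ)‖ + ‖(T : ℂ) * I‖) + ‖(charParity χ : ℂ)‖ := by gcongr; exact norm_add_le _ _
          _ = |x| + |T| + charParity χ := by simp
      rw [abs_of_pos hT0, abs_of_pos (by linarith [hx.1])] at this
      linarith [hx.2]
    have hd := norm_digamma_le_log_height hvre hvim hvn
    have hlog : ‖(Real.log (q / Real.pi) : ℂ) / 2‖ = |Real.log (q / Real.pi)| / 2 := by
      rw [norm_div, Complex.norm_real, Complex.norm_two, Real.norm_eq_abs]
    calc ‖(Real.log (q / Real.pi) : ℂ) / 2 + 1 / 2 * Complex.digamma v‖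
        ≤ ‖(Real.log (q / Real.pi) : ℂ) / 2‖ + ‖(1 / 2 : ℂ) * Complex.digamma v‖ := norm_add_le _ _
      _ ≤ |Real.log (q / Real.pi)| / 2 + 1 / 2 * (Real.log (T + 4) + 8) := by
          rw [hlog, norm_mul]
          gcongr
          simp
      _ = Real.log (T + 4) / 2 + 4 + |Real.log (q / Real.pi)| / 2 := by ring
  -- the weight factor
  have hk : ‖liSymWeight n w‖ ≤ 1 + Real.exp 1 := by
    unfold liSymWeight
    refine (norm_add_le _ _).trans (add_le_add ?_ (norm_liWeight_one_sub_le n hx.2 hT0 hn))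
    -- `|F_n(w)| ≤ 1` for `Re w ≥ 1/2`
    unfold liWeight
    rw [norm_pow]
    refine pow_le_one₀ (norm_nonneg _) ?_
    have hw0 : w ≠ 0 := fun h0 ↦ by have := congrArg Complex.im h0; simp [hw] at this; exact hT0.ne' this
    rw [show (1 : ℂ) - 1 / w = (w - 1) / w by field_simp, norm_div, div_le_one (norm_pos_iff.2 hw0)]
    have h1 : ‖w - 1‖ ^ 2 ≤ ‖w‖ ^ 2 := by
      rw [Complex.sq_norm, Complex.sq_norm, Complex.normSq_apply, Complex.normSq_apply]
      simp [hw]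
      nlinarith [hx.1]
    exact (pow_le_pow_iff_left₀ (norm_nonneg _) (norm_nonneg _) two_ne_zero).1 h1
  unfold gammaIntegrand
  rw [norm_mul]
  have hlog0 : 0 ≤ Real.log (T + 4) := Real.log_nonneg (by linarith)
  have habs0 : 0 ≤ |Real.log (q / Real.pi)| := abs_nonneg _
  exact mul_le_mul hψ hk (norm_nonneg _) (by linarith)

/-- A horizontal connector costs `≤ (log(T + 4)/2 + 4 + |log(q/π)|/2)(1 + e)` (`T ≥ 1`, `T² ≥ n`). -/
theorem norm_integral_connector_le (χ : DirichletCharacter ℂ q) (n : ℕ) {T : ℝ} (hT : 1 ≤ T) (hn : (n : ℝ) ≤ T ^ 2) :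
    ‖∫ x in (1 / 2 : ℝ)..(3 / 2 : ℝ), gammaIntegrand χ n (x + T * I)‖ ≤
      (Real.log (T + 4) / 2 + 4 + |Real.log (q / Real.pi)| / 2) * (1 + Real.exp 1) := by
  have hpt : ∀ x ∈ Ι (1 / 2 : ℝ) (3 / 2), ‖gammaIntegrand χ n (x + T * I)‖ ≤
      (Real.log (T + 4) / 2 + 4 + |Real.log (q / Real.pi)| / 2) * (1 + Real.exp 1) := by
    intro x hx
    rw [uIoc_of_le (by norm_num)] at hx
    exact norm_gammaIntegrand_le χ n ⟨hx.1.le, hx.2⟩ hT hn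
  have h := intervalIntegral.norm_integral_le_of_norm_le_const hpt
  have hlen : |(3 / 2 : ℝ) - 1 / 2| = 1 := by norm_num
  rw [hlen, mul_one] at h
  exact h

/-! ### Cauchy: the right edge equals the critical line plus the connectors -/

/-- For `0 < T₁ ≤ T₂`: `charGammaEdge χ n T₁ T₂ − charSmoothTraceWindow χ n T₁ T₂ = (1/π) Im(∫_top − ∫_bot)` where
`∫_top/bot = ∫_{1/2}^{3/2} G(x + iT₂/T₁) dx`. -/
theorem gammaEdge_sub_smooth_eq (χ : DirichletCharacter ℂ q) (n : ℕ) {T₁ T₂ : ℝ} (hT₁ : 0 < T₁) (hT : T₁ ≤ T₂) :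
    charGammaEdge χ n T₁ T₂ - charSmoothTraceWindow χ n T₁ T₂ =
      1 / Real.pi * ((∫ x in (1 / 2 : ℝ)..(3 / 2 : ℝ), gammaIntegrand χ n (x + T₂ * I)) -
        ∫ x in (1 / 2 : ℝ)..(3 / 2 : ℝ), gammaIntegrand χ n (x + T₁ * I)).im := by
  -- adapted from `GammaShift.gammaEdge_sub_smooth_eq` (Theorems/LiPrimeEchoGammaShift.lean, route LiPrimeEcho)
  have hC := Complex.integral_boundary_rect_eq_zero_of_differentiableOn (gammaIntegrand χ n) (1 / 2 + T₁ * I)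
    (3 / 2 + T₂ * I) (by
      have h1 : ((1 : ℂ) / 2 + T₁ * I).re = 1 / 2 := by simp
      have h2 : ((3 : ℂ) / 2 + T₂ * I).re = 3 / 2 := by simp
      have h3 : ((1 : ℂ) / 2 + T₁ * I).im = T₁ := by simp
      have h4 : ((3 : ℂ) / 2 + T₂ * I).im = T₂ := by simp
      rw [h1, h2, h3, h4]
      exact differentiableOn_gammaIntegrand χ n (by norm_num) (by norm_num) hT₁ hT)
  simp only [Complex.add_re, Complex.add_im, Complex.div_ofNat_re, Complex.one_re, Complex.mul_re, Complex.ofReal_re,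
    Complex.I_re, Complex.ofReal_im, Complex.I_im, Complex.div_ofNat_im, Complex.one_im, Complex.mul_im,
    Complex.re_ofNat, Complex.im_ofNat] at hC
  norm_num at hC
  set IR := ∫ y in T₁..T₂, gammaIntegrand χ n (3 / 2 + y * I) with hIR
  set IL := ∫ y in T₁..T₂, gammaIntegrand χ n (1 / 2 + y * I) with hIL
  set Itop := ∫ x in (1 / 2 : ℝ)..(3 / 2 : ℝ), gammaIntegrand χ n (x + T₂ * I) with hItop
  set Ibot := ∫ x in (1 / 2 : ℝ)..(3 / 2 : ℝ), gammaIntegrand χ n (x + T₁ * I) with hIbot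
  have hRL : IR = IL - I * (Itop - Ibot) := by
    have hI : I * I = -1 := Complex.I_mul_I
    linear_combination (-I) * hC + (IR - IL) * hI
  -- the right edge is the gamma edge
  have hedge : charGammaEdge χ n T₁ T₂ = 1 / Real.pi * IR.re := by
    rw [hIR]; rfl
  -- the left edge is the smooth mean
  have hleft : IL.re = ∫ y in T₁..T₂, 2 * Real.cos (n * liZeroAngle y) * charGammaDensity χ y := by
    have hcont : ContinuousOn (fun y : ℝ ↦ gammaIntegrand χ n (1 / 2 + y * I)) (uIcc T₁ T₂) := by
      refine continuousOn_of_forall_continuousAt fun y hy ↦ ?_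
      rw [uIcc_of_le hT] at hy
      have hy0 : 0 < y := hT₁.trans_le hy.1
      have hd := differentiableAt_gammaIntegrand χ n (w := 1 / 2 + y * I) (by simp) (by simp; exact hy0.ne')
      have hc2 : Continuous fun y : ℝ ↦ (1 : ℂ) / 2 + y * I := by fun_prop
      show ContinuousAt ((gammaIntegrand χ n) ∘ fun y : ℝ ↦ (1 : ℂ) / 2 + y * I) y
      exact ContinuousAt.comp hd.continuousAt hc2.continuousAt
    have hi : IntervalIntegrable (fun y : ℝ ↦ gammaIntegrand χ n (1 / 2 + y * I)) volume T₁ T₂ :=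
      hcont.intervalIntegrable
    have hcomm := ContinuousLinearMap.intervalIntegral_comp_comm Complex.reCLM hi
    simp only [Complex.reCLM_apply] at hcomm
    rw [hIL, ← hcomm]
    refine intervalIntegral.integral_congr fun y hy ↦ ?_
    rw [uIcc_of_le hT] at hy
    exact re_gammaIntegrand_half_line χ n (hT₁.trans_le hy.1).ne'
  have hsmooth : charSmoothTraceWindow χ n T₁ T₂ = 1 / Real.pi * IL.re := by
    unfold charSmoothTraceWindow
    rw [hleft, ← intervalIntegral.integral_const_mul, ← intervalIntegral.integral_const_mul]
    refine intervalIntegral.integral_congr fun y _ ↦ ?_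
    ring
  rw [hedge, hsmooth, hRL]
  simp only [Complex.sub_re, Complex.mul_re, Complex.I_re, Complex.I_im, zero_mul, one_mul, zero_sub]
  ring

end GammaShiftChar

open GammaShiftChar in
/-- **Crux K4χ `LiGammaShiftChar` of route `LiDirichletEcho`, for EVERY character** (stmt-RiemannHypothesis-19400;
RH-FREE, GRH-FREE): for `c ≥ 1` there are `N`, `C` with `|charGammaEdge χ n T₁ T₂ − charSmoothTraceWindow χ n T₁ T₂| ≤ C log n`
whenever `n ≥ N`, `√n ≤ T₁ < T₂ ≤ c√n + 1`. -/
theorem liGammaShiftChar_bound {q : ℕ} [NeZero q] (χ : DirichletCharacter ℂ q) :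
    ∀ c : ℝ, 1 ≤ c → ∃ N : ℕ, ∃ C : ℝ, ∀ n : ℕ, N ≤ n → ∀ T₁ T₂ : ℝ, Real.sqrt n ≤ T₁ → T₁ < T₂ →
      T₂ ≤ c * Real.sqrt n + 1 → |charGammaEdge χ n T₁ T₂ - charSmoothTraceWindow χ n T₁ T₂| ≤ C * Real.log n := by
  -- adapted from `liGammaShift_bound` (Theorems/LiPrimeEchoGammaShift.lean, route LiPrimeEcho)
  intro c hc
  set Kq : ℝ := |Real.log (q / Real.pi)| / 2 with hKq
  have hKq0 : 0 ≤ Kq := by positivity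
  refine ⟨⌈(c + 5) ^ 2⌉₊, (9 + 2 * Kq) * (1 + Real.exp 1), fun n hn T₁ T₂ hT₁ hT₁₂ hT₂ ↦ ?_⟩
  -- sizes
  have hc5 : (c + 5) ^ 2 ≤ (n : ℝ) := (Nat.le_ceil _).trans (by exact_mod_cast hn)
  set s := Real.sqrt n with hs
  have hn0 : (0 : ℝ) ≤ n := by positivity
  have hss : s ^ 2 = n := by rw [hs, Real.sq_sqrt hn0]
  have hs6 : c + 5 ≤ s := by
    rw [hs, ← Real.sqrt_sq (by linarith : 0 ≤ c + 5)]; exact Real.sqrt_le_sqrt hc5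
  have hs1 : 1 ≤ s := by linarith
  have hT₁1 : 1 ≤ T₁ := hs1.trans hT₁
  have hT₁0 : 0 < T₁ := by linarith
  have hn1 : (n : ℝ) ≤ T₁ ^ 2 := by rw [← hss]; exact pow_le_pow_left₀ (by linarith) hT₁ 2
  have hn2 : (n : ℝ) ≤ T₂ ^ 2 := hn1.trans (pow_le_pow_left₀ hT₁0.le hT₁₂.le 2)
  have htop : T₂ + 4 ≤ n := by
    have : (c + 5) * s ≤ s * s := mul_le_mul_of_nonneg_right hs6 (by linarith)
    nlinarith
  have hn36 : (36 : ℝ) ≤ n := by nlinarith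
  have hlogn1 : 1 ≤ Real.log n := by
    rw [Real.le_log_iff_exp_le (by linarith)]
    have := Real.exp_one_lt_d9; linarith
  have hl2 : Real.log (T₂ + 4) ≤ Real.log n := Real.log_le_log (by linarith) htop
  have hl1 : Real.log (T₁ + 4) ≤ Real.log n := Real.log_le_log (by linarith) (by linarith)
  -- Cauchy
  rw [gammaEdge_sub_smooth_eq χ n hT₁0 hT₁₂.le, abs_mul, abs_of_pos (by positivity : (0 : ℝ) < 1 / Real.pi)]
  have htop' := norm_integral_connector_le χ n (by linarith : (1 : ℝ) ≤ T₂) hn2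
  have hbot' := norm_integral_connector_le χ n hT₁1 hn1
  rw [← hKq] at htop' hbot'
  have him := Complex.abs_im_le_norm
    ((∫ x in (1 / 2 : ℝ)..(3 / 2 : ℝ), gammaIntegrand χ n (x + T₂ * I)) -
      ∫ x in (1 / 2 : ℝ)..(3 / 2 : ℝ), gammaIntegrand χ n (x + T₁ * I))
  have hdiff := (him.trans (norm_sub_le _ _)).trans (add_le_add htop' hbot')
  have hπ : 1 / Real.pi ≤ 1 := by rw [div_le_one Real.pi_pos]; linarith [Real.pi_gt_three]
  have he := Real.exp_pos 1
  have hsum : (Real.log (T₂ + 4) / 2 + 4 + Kq) * (1 + Real.exp 1) + (Real.log (T₁ + 4) / 2 + 4 + Kq) * (1 + Real.exp 1)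
      ≤ (9 + 2 * Kq) * (1 + Real.exp 1) * Real.log n := by
    have h1 : Real.log (T₂ + 4) / 2 + 4 + Kq + (Real.log (T₁ + 4) / 2 + 4 + Kq) ≤ (9 + 2 * Kq) * Real.log n := by
      nlinarith
    have e : (Real.log (T₂ + 4) / 2 + 4 + Kq) * (1 + Real.exp 1) + (Real.log (T₁ + 4) / 2 + 4 + Kq) * (1 + Real.exp 1)
        = (Real.log (T₂ + 4) / 2 + 4 + Kq + (Real.log (T₁ + 4) / 2 + 4 + Kq)) * (1 + Real.exp 1) := by ring
    rw [e, mul_assoc, mul_comm (1 + Real.exp 1) (Real.log n), ← mul_assoc]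
    exact mul_le_mul_of_nonneg_right h1 (by linarith)
  calc 1 / Real.pi * |((∫ x in (1 / 2 : ℝ)..(3 / 2 : ℝ), gammaIntegrand χ n (x + T₂ * I)) -
          ∫ x in (1 / 2 : ℝ)..(3 / 2 : ℝ), gammaIntegrand χ n (x + T₁ * I)).im|
      ≤ 1 * ((Real.log (T₂ + 4) / 2 + 4 + Kq) * (1 + Real.exp 1)
          + (Real.log (T₁ + 4) / 2 + 4 + Kq) * (1 + Real.exp 1)) :=
        mul_le_mul hπ hdiff (abs_nonneg _) zero_le_one
    _ ≤ (9 + 2 * Kq) * (1 + Real.exp 1) * Real.log n := by rw [one_mul]; exact hsum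

/-- **Item `LiGammaShiftChar` of route `LiDirichletEcho`** (stmt-RiemannHypothesis-19400), closed BY NAME (the
hypotheses `χ.IsPrimitive`, `1 < q` of the route statement are not needed). -/
theorem liGammaShiftChar_proof :
    Summit.RiemannHypothesis.RiemannHypothesis.Theses.LiDirichletEcho.LiGammaShiftChar :=
  fun _ _ χ _ _ ↦ liGammaShiftChar_bound χ

end Summit.RiemannHypothesis.RiemannHypothesis.Theorems.LiTheory

end
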